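import Mathlib
import Summits.PneNP.PneNP.Theorems.ConvexRankGatesConvexGateBlindAffinePencil

/-!
# PneNP / ConvexRankGates — `ConvexGateBlind`: the swap lemma — an excluded bare clique is the TOP edge set of its witness

Helpers (`--supports stmt-PneNP-10680`), COLUMN-SPACE line (prover seat 2, session 26), PSD side of the transposed restricted
class. Single-edge swaps of a bare clique are clique-free:

* `swapGraph_cliqueFree` — for `3 ≤ k`, a `k`-set `Q`, `e ∈ E(Q)` and `e' ∉ E(Q)`, the graph `E(Q) − e + e'` has no
  `k`-clique (every vertex of a `k`-clique has two clique-neighbours, and at most one of its edges can be `e'`, so the clique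
  lies in `Q`, is `Q`, and would contain `e`); likewise `E(Q) − e` (`eraseEdgeGraph_cliqueFree`).

Consequences for a VALID INEQUALITY `t·x ≤ a` of the `k`-clique-free polytope that CATCHES the bare clique `Q`
(`t(E(Q)) > a`):
* `valid_catch_swap_lt` — `t e' < t e` for every `e ∈ E(Q)`, `e' ∉ E(Q)`: the edge set of a caught clique is the set of
  the `C(k,2)` STRICTLY HEAVIEST edges of `t` (whence a second, one-line proof of the uniqueness of the caught clique:
  private edges of two caught cliques contradict each other, `not_private_pair_of_caught`, `exists_private_edge`);
* `valid_catch_edge_gt` — `t e > t(E(Q)) − a > 0` for every `e ∈ E(Q)`.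

And for a dual-affine PSD pencil `H(x) = H₀ − ∑_e x_e H_e`, PSD on every `k`-clique-free graph, that EXCLUDES `Q`
(`H(1_{E(Q)}) ⋡ 0`, witness `y`):
* `pencil_swap_lt` — `yᵀ H_{e'} y < yᵀ H_e y` for `e ∈ E(Q)`, `e' ∉ E(Q)`: in the witness direction the edge matrices of `Q`
  dominate all other edge matrices — `E(Q)` is the top-`C(k,2)` set of `e ↦ yᵀH_e y`;
* `pencil_edge_form_pos` — `yᵀ H_e y > 0` for `e ∈ E(Q)`.
So the set of bare cliques a valid `q × q` pencil excludes injects into the set of top-`C(k,2)` sets of the quadratic family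
`{e ↦ yᵀH_e y : y ∈ ℝ^q}` — the structural fact behind every upper bound on the pencil exclusion number `c(q)` (sign
patterns of the `C(C(m,2),2)` quadrics `yᵀ(H_e − H_{e'})y`; memo ANALYSIS-seat2-s26 §3). [new]
-/

set_option linter.dupNamespace false

namespace Summit.PneNP.PneNP.Theorems

open Finset Real Matrix Literature.Computability.Complexity
open Summit.PneNP.PneNP.Cruxes.ConvexGateBlind.StrictRankConicCover (Edge cdist)

noncomputable section

variable {m : ℕ}

/-! ## Graphs whose edges are clique edges plus at most one extra edge -/

/-- If every edge of the graph `u` is an edge of the clique on `Q` or the single edge `e'`, then for `3 ≤ k` every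
`k`-clique of `u` lies inside `Q`: a vertex outside `Q` would need two distinct edges equal to `e'`. [new] -/
theorem subset_of_isNClique_of_edges {k : ℕ} (hk : 3 ≤ k) {u : Edge m → Bool} {Q : Finset (Fin m)} {e' : Edge m}
    (hu : ∀ f : Edge m, u f = true → f ∈ cliqueEdges Q ∨ f = e') {Z : Finset (Fin m)}
    (hZ : (cliqueGraph u).IsNClique k Z) : Z ⊆ Q := by
  classical
  intro z hz
  by_contra hzQ
  -- two distinct neighbours of `z` inside `Z`
  have hcard : 1 < (Z.erase z).card := by
    rw [Finset.card_erase_of_mem hz, hZ.card_eq]; omega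
  obtain ⟨w₁, hw₁, w₂, hw₂, hne⟩ := Finset.one_lt_card.1 hcard
  have hw₁Z := Finset.mem_of_mem_erase hw₁
  have hw₂Z := Finset.mem_of_mem_erase hw₂
  have hzw₁ : z ≠ w₁ := fun h => (Finset.ne_of_mem_erase hw₁) h.symm
  have hzw₂ : z ≠ w₂ := fun h => (Finset.ne_of_mem_erase hw₂) h.symm
  -- both edges `{z, wᵢ}` are on, and neither is a clique edge of `Q`
  have hedge : ∀ w : Fin m, w ∈ Z → ∀ hzw : z ≠ w,
      (⟨s(z, w), by simpa using hzw⟩ : Edge m) = e' := by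
    intro w hwZ hzw
    have hadj : (cliqueGraph u).Adj z w := hZ.isClique hz hwZ hzw
    rw [cliqueGraph_adj] at hadj
    obtain ⟨hzw', hx⟩ := hadj
    rcases hu _ hx with hQ | hQ
    · exact absurd ((mk_mem_cliqueEdges hzw').1 hQ).1 hzQ
    · exact hQ
  have h₁ := hedge w₁ hw₁Z hzw₁
  have h₂ := hedge w₂ hw₂Z hzw₂
  have h12 : (⟨s(z, w₁), by simpa using hzw₁⟩ : Edge m) = ⟨s(z, w₂), by simpa using hzw₂⟩ := h₁.trans h₂.symm
  have : s(z, w₁) = s(z, w₂) := congrArg Subtype.val h12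
  exact hne (Sym2.congr_right.1 this)

/-- The swap graph `E(Q) − e + e'`. [new] -/
def swapGraph (Q : Finset (Fin m)) (e e' : Edge m) : Edge m → Bool :=
  fun f => decide (f ∈ insert e' ((cliqueEdges Q).erase e))

/-- The graph `E(Q) − e`. [new] -/
def eraseEdgeGraph (Q : Finset (Fin m)) (e : Edge m) : Edge m → Bool :=
  fun f => decide (f ∈ (cliqueEdges Q).erase e)

/-- **Single swaps of a bare clique are clique-free.** For `3 ≤ k`, `#Q = k`, `e ∈ E(Q)`, `e' ∉ E(Q)`: the graph
`E(Q) − e + e'` has no `k`-clique. [new] -/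
theorem swapGraph_cliqueFree {k : ℕ} (hk : 3 ≤ k) {Q : Finset (Fin m)} (hQ : Q.card = k) {e e' : Edge m}
    (he : e ∈ cliqueEdges Q) (he' : e' ∉ cliqueEdges Q) : cliqueFn m k (swapGraph Q e e') = false := by
  classical
  rw [cliqueFn_eq_false_iff]
  intro Z hZ
  have hu : ∀ f : Edge m, swapGraph Q e e' f = true → f ∈ cliqueEdges Q ∨ f = e' := by
    intro f hf
    simp only [swapGraph, decide_eq_true_eq, Finset.mem_insert, Finset.mem_erase] at hf
    rcases hf with h | ⟨-, h⟩
    · exact Or.inr h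
    · exact Or.inl h
  have hZQ : Z ⊆ Q := subset_of_isNClique_of_edges hk hu hZ
  -- `Z = Q` uses the edge `e`, which is off
  have hon : swapGraph Q e e' e = true := apply_eq_true_of_isNClique hZ hZQ hQ he
  simp only [swapGraph, decide_eq_true_eq, Finset.mem_insert, Finset.mem_erase] at hon
  rcases hon with h | ⟨h, -⟩
  · exact he' (h ▸ he)
  · exact h rfl

/-- `E(Q) − e` is `k`-clique-free (`3 ≤ k`, `#Q = k`, `e ∈ E(Q)`). [folklore] -/
theorem eraseEdgeGraph_cliqueFree {k : ℕ} (hk : 3 ≤ k) {Q : Finset (Fin m)} (hQ : Q.card = k) {e : Edge m}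
    (he : e ∈ cliqueEdges Q) : cliqueFn m k (eraseEdgeGraph Q e) = false := by
  classical
  rw [cliqueFn_eq_false_iff]
  intro Z hZ
  have hu : ∀ f : Edge m, eraseEdgeGraph Q e f = true → f ∈ cliqueEdges Q ∨ f = e := by
    intro f hf
    simp only [eraseEdgeGraph, decide_eq_true_eq, Finset.mem_erase] at hf
    exact Or.inl hf.2
  have hZQ : Z ⊆ Q := subset_of_isNClique_of_edges hk hu hZ
  have hon : eraseEdgeGraph Q e e = true := apply_eq_true_of_isNClique hZ hZQ hQ he
  simp only [eraseEdgeGraph, decide_eq_true_eq, Finset.mem_erase] at hon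
  exact hon.1 rfl

/-! ## Edge sums over the swap graphs -/

/-- `t(E(Q) − e + e') = t(E(Q)) − t e + t e'`. [folklore] -/
theorem sum_ite_swapGraph {Q : Finset (Fin m)} {e e' : Edge m} (he : e ∈ cliqueEdges Q) (he' : e' ∉ cliqueEdges Q)
    (t : Edge m → ℝ) :
    (∑ f, if swapGraph Q e e' f = true then t f else 0) = (∑ f ∈ cliqueEdges Q, t f) - t e + t e' := by
  classical
  have h1 : (∑ f, if swapGraph Q e e' f = true then t f else 0) = ∑ f ∈ insert e' ((cliqueEdges Q).erase e), t f := by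
    rw [← Finset.sum_filter]
    refine Finset.sum_congr ?_ fun _ _ => rfl
    ext f
    simp [swapGraph]
  have he'' : e' ∉ (cliqueEdges Q).erase e := fun h => he' (Finset.mem_of_mem_erase h)
  rw [h1, Finset.sum_insert he'', ← Finset.add_sum_erase _ _ he]
  ring

/-- `t(E(Q) − e) = t(E(Q)) − t e`. [folklore] -/
theorem sum_ite_eraseEdgeGraph {Q : Finset (Fin m)} {e : Edge m} (he : e ∈ cliqueEdges Q) (t : Edge m → ℝ) :
    (∑ f, if eraseEdgeGraph Q e f = true then t f else 0) = (∑ f ∈ cliqueEdges Q, t f) - t e := by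
  classical
  have h1 : (∑ f, if eraseEdgeGraph Q e f = true then t f else 0) = ∑ f ∈ (cliqueEdges Q).erase e, t f := by
    rw [← Finset.sum_filter]
    refine Finset.sum_congr ?_ fun _ _ => rfl
    ext f
    simp [eraseEdgeGraph]
  rw [h1, ← Finset.add_sum_erase _ _ he]
  ring

/-! ## Valid inequalities catching a bare clique: the caught clique is the set of heaviest edges -/

/-- **Swap lemma (LP form).** If `t·x ≤ a` holds on every `k`-clique-free graph (`3 ≤ k`) and the bare clique `Q` violates
it, then every edge of `Q` is STRICTLY heavier than every non-edge of `Q`. [new] -/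
theorem valid_catch_swap_lt {k : ℕ} (hk : 3 ≤ k) (t : Edge m → ℝ) (a : ℝ)
    (hvalid : ∀ u : Edge m → Bool, cliqueFn m k u = false → (∑ f, if u f = true then t f else 0) ≤ a)
    {Q : Finset (Fin m)} (hQ : Q.card = k) (hcQ : a < ∑ f ∈ cliqueEdges Q, t f)
    {e e' : Edge m} (he : e ∈ cliqueEdges Q) (he' : e' ∉ cliqueEdges Q) : t e' < t e := by
  have h := hvalid _ (swapGraph_cliqueFree hk hQ he he')
  rw [sum_ite_swapGraph he he'] at h
  linarith

/-- **Edges of a caught clique carry more than the violation.** With the same hypotheses, `t e > t(E(Q)) − a > 0` for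
every `e ∈ E(Q)`. [new] -/
theorem valid_catch_edge_gt {k : ℕ} (hk : 3 ≤ k) (t : Edge m → ℝ) (a : ℝ)
    (hvalid : ∀ u : Edge m → Bool, cliqueFn m k u = false → (∑ f, if u f = true then t f else 0) ≤ a)
    {Q : Finset (Fin m)} (hQ : Q.card = k) {e : Edge m} (he : e ∈ cliqueEdges Q) :
    (∑ f ∈ cliqueEdges Q, t f) - a ≤ t e := by
  have h := hvalid _ (eraseEdgeGraph_cliqueFree hk hQ he)
  rw [sum_ite_eraseEdgeGraph he] at h
  linarith

/-- **Uniqueness of the caught clique, second proof** (by swaps): two caught `k`-sets `Q ≠ Q'` would have private edges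
`e ∈ E(Q) ∖ E(Q')`, `e' ∈ E(Q') ∖ E(Q)` with `t e' < t e` (from `Q`) and `t e < t e'` (from `Q'`).
(`caught_clique_unique` in `…AffineUnique.lean` is the first proof.) [new] -/
theorem exists_private_edge {k : ℕ} (hk : 2 ≤ k) {Q Q' : Finset (Fin m)} (hQ : Q.card = k) (hQ' : Q'.card = k)
    (hne : Q ≠ Q') : ∃ e ∈ cliqueEdges Q, e ∉ cliqueEdges Q' := by
  classical
  have hnot : ¬ Q ⊆ Q' := fun h => hne (Finset.eq_of_subset_of_card_le h (by rw [hQ, hQ']))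
  obtain ⟨x, hxQ, hxQ'⟩ := Finset.not_subset.1 hnot
  have hcard : 0 < (Q.erase x).card := by rw [Finset.card_erase_of_mem hxQ, hQ]; omega
  obtain ⟨y, hy⟩ := Finset.card_pos.1 hcard
  obtain ⟨hyx, hyQ⟩ := Finset.mem_erase.1 hy
  refine ⟨⟨s(x, y), by simpa using (Ne.symm hyx)⟩, (mk_mem_cliqueEdges (Ne.symm hyx)).2 ⟨hxQ, hyQ⟩, fun h => ?_⟩
  exact hxQ' ((mk_mem_cliqueEdges (Ne.symm hyx)).1 h).1

/-- **Private edges of two caught cliques contradict each other** (the swap proof of uniqueness: `caught_clique_unique`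
in `…AffineUnique.lean` follows at once from `exists_private_edge`): if `Q` and `Q'` are both caught then no edge is private
to `Q` while another is private to `Q'`. [new] -/
theorem not_private_pair_of_caught {k : ℕ} (hk : 3 ≤ k) (t : Edge m → ℝ) (a : ℝ)
    (hvalid : ∀ u : Edge m → Bool, cliqueFn m k u = false → (∑ f, if u f = true then t f else 0) ≤ a)
    {Q Q' : Finset (Fin m)} (hQ : Q.card = k) (hQ' : Q'.card = k)
    (hcQ : a < ∑ f ∈ cliqueEdges Q, t f) (hcQ' : a < ∑ f ∈ cliqueEdges Q', t f)
    {e e' : Edge m} (he : e ∈ cliqueEdges Q) (he'Q : e' ∉ cliqueEdges Q) (he' : e' ∈ cliqueEdges Q') :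
    e ∈ cliqueEdges Q' := by
  by_contra heQ'
  have h1 := valid_catch_swap_lt hk t a hvalid hQ hcQ he he'Q
  have h2 := valid_catch_swap_lt hk t a hvalid hQ' hcQ' he' heQ'
  linarith

/-! ## Dual-affine PSD pencils: an excluded clique is the top edge set of its witness direction -/

/-- **Swap lemma (pencil form).** Let `3 ≤ k` and let `H(x) = H₀ − ∑_e x_e H_e` be a `q × q` affine pencil that is PSD on
every `k`-clique-free graph. If `y` witnesses that the bare clique `Q` is excluded (`yᵀH(1_{E(Q)})y < 0`), then
`yᵀ H_{e'} y < yᵀ H_e y` for every `e ∈ E(Q)` and `e' ∉ E(Q)`: in the witness direction, `E(Q)` is the set of the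
`C(k,2)` strictly largest edge forms. [new] -/
theorem pencil_swap_lt {k q : ℕ} (hk : 3 ≤ k) (H₀ : Matrix (Fin q) (Fin q) ℝ) (He : Edge m → Matrix (Fin q) (Fin q) ℝ)
    (hvalid : ∀ u : Edge m → Bool, cliqueFn m k u = false → (H₀ - ∑ e, if u e = true then He e else 0).PosSemidef)
    (y : Fin q → ℝ) {Q : Finset (Fin m)} (hQ : Q.card = k)
    (hcQ : y ⬝ᵥ ((H₀ - ∑ e, if cliqueVec Q e = true then He e else 0) *ᵥ y) < 0)
    {e e' : Edge m} (he : cliqueVec Q e = true) (he' : cliqueVec Q e' = false) :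
    y ⬝ᵥ (He e' *ᵥ y) < y ⬝ᵥ (He e *ᵥ y) := by
  classical
  set t : Edge m → ℝ := fun f => y ⬝ᵥ (He f *ᵥ y) with ht
  set a : ℝ := y ⬝ᵥ (H₀ *ᵥ y) with ha
  have hform : ∀ c : Edge m → Bool, y ⬝ᵥ ((H₀ - ∑ f, if c f = true then He f else 0) *ᵥ y) =
      a - ∑ f, (if c f = true then t f else 0) := fun c => dotProduct_pencil_mulVec H₀ He c y
  have hvalid' : ∀ u : Edge m → Bool, cliqueFn m k u = false → (∑ f, if u f = true then t f else 0) ≤ a := by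
    intro u hu
    have h := (hvalid u hu).dotProduct_mulVec_nonneg y
    rw [star_trivial, hform u] at h
    linarith
  have hcQ' : a < ∑ f ∈ cliqueEdges Q, t f := by
    rw [hform, ← sum_cliqueEdges] at hcQ; linarith
  have heE : e ∈ cliqueEdges Q := by simpa [cliqueEdges] using he
  have he'E : e' ∉ cliqueEdges Q := by simpa [cliqueEdges] using he'
  exact valid_catch_swap_lt hk t a hvalid' hQ hcQ' heE he'E

/-- **Edge forms of a bare clique dominate its violation**: `yᵀH_e y ≥ −yᵀH(1_{E(Q)})y` for `e ∈ E(Q)` (so the edge forms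
of an EXCLUDED clique are positive in the witness direction). [new] -/
theorem pencil_edge_form_pos {k q : ℕ} (hk : 3 ≤ k) (H₀ : Matrix (Fin q) (Fin q) ℝ) (He : Edge m → Matrix (Fin q) (Fin q) ℝ)
    (hvalid : ∀ u : Edge m → Bool, cliqueFn m k u = false → (H₀ - ∑ e, if u e = true then He e else 0).PosSemidef)
    (y : Fin q → ℝ) {Q : Finset (Fin m)} (hQ : Q.card = k)
    {e : Edge m} (he : cliqueVec Q e = true) :
    -(y ⬝ᵥ ((H₀ - ∑ e, if cliqueVec Q e = true then He e else 0) *ᵥ y)) ≤ y ⬝ᵥ (He e *ᵥ y) := by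
  classical
  set t : Edge m → ℝ := fun f => y ⬝ᵥ (He f *ᵥ y) with ht
  set a : ℝ := y ⬝ᵥ (H₀ *ᵥ y) with ha
  have hform : ∀ c : Edge m → Bool, y ⬝ᵥ ((H₀ - ∑ f, if c f = true then He f else 0) *ᵥ y) =
      a - ∑ f, (if c f = true then t f else 0) := fun c => dotProduct_pencil_mulVec H₀ He c y
  have hvalid' : ∀ u : Edge m → Bool, cliqueFn m k u = false → (∑ f, if u f = true then t f else 0) ≤ a := by
    intro u hu
    have h := (hvalid u hu).dotProduct_mulVec_nonneg y
    rw [star_trivial, hform u] at h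
    linarith
  have heE : e ∈ cliqueEdges Q := by simpa [cliqueEdges] using he
  have h := valid_catch_edge_gt hk t a hvalid' hQ heE
  rw [hform, ← sum_cliqueEdges]
  linarith

/-- **The swap lemma for dual-affine PSD pencils** (registered form of `pencil_swap_lt`): for `3 ≤ k` and an affine
`q × q` pencil PSD on every `k`-clique-free graph, if `yᵀ H(1_{E(Q)}) y < 0` then `yᵀH_{e'}y < yᵀH_e y` for all `e ∈ E(Q)`,
`e' ∉ E(Q)` — an excluded bare clique is the top-`C(k,2)` edge set of the quadratic family `e ↦ yᵀH_e y` at its witness. [new] -/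
theorem pencil_excluded_clique_top_edges : ∀ {m k q : ℕ}, 3 ≤ k → ∀ (H₀ : Matrix (Fin q) (Fin q) ℝ) (He : Edge m → Matrix (Fin q) (Fin q) ℝ), (∀ u : Edge m → Bool, cliqueFn m k u = false → (H₀ - ∑ e, if u e = true then He e else 0).PosSemidef) → ∀ (y : Fin q → ℝ) (Q : Finset (Fin m)), Q.card = k → y ⬝ᵥ ((H₀ - ∑ e, if cliqueVec Q e = true then He e else 0) *ᵥ y) < 0 → ∀ e e' : Edge m, cliqueVec Q e = true → cliqueVec Q e' = false → y ⬝ᵥ (He e' *ᵥ y) < y ⬝ᵥ (He e *ᵥ y) :=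
  fun hk H₀ He hvalid y _ hQ hcQ _ _ he he' => pencil_swap_lt hk H₀ He hvalid y hQ hcQ he he'

end

end Summit.PneNP.PneNP.Theorems
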